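import Summits.Ventures.HodgeRepro2.T6N3Interface
import Summits.Ventures.HodgeRepro2.T6N3ToyV

/-!
# T6N3TrivGroup — under a TRIVIAL `G(𝔸_f)`-action the N3 interface puts all products on ONE line

Cell pub-hodge-repro2, Tier 6 (README §10), seat t6-p3 (N3 owner, M2). Proof lane; count-neutral.
Every toy datum of the cell so far has `Gf = Unit` and `ρ = id`. This file records, in kernel, what
the N3.L8 interface Props then force — the boundary that any joint toy over `NAut3` (t6-p1's spec
(S6)/(S7), STATUS l. 11284; the lead's assignment l. 11316 (4)) must respect when it places the two
sides' products `F_A(φ_a, φ_b) = (φ_a φ_b) • f_A` and `F_B(φ_c, φ_d) = (φ_c φ_d) • f_B`: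
* `AutNonIso` (no non-zero equivariant map between the τ-parts of distinct `σ′`) — under a trivial
  action EVERY linear map is equivariant, so at most one τ-part `aut i ⊓ τiso` is non-zero
  (`eq_of_tauPart_ne_bot`);
* `AutSimple` (the τ-part is irreducible) — under a trivial action every subspace is stable, so the
  non-zero τ-part is a LINE (`tauPart_eq_span_singleton`); hence `𝒱 = V20` is a line or `⊥`
  (`exists_V20_eq_span_singleton`);
* `ProductsIn20` on both sides then puts every product of side A and of side B on that one line
  (`exists_products_mem_span_singleton`): in particular `f_B ∈ ℂ ∙ f_A` whenever `f_A ≠ 0`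
  (`B_F_mem_span_A_F`).
So the hypothesis `w ∈ ℂ ∙ v` of T6N3ToyV / T6N3Toy2V's `toyVW V v w` is NECESSARY, not a
convenience: a joint toy with a trivial `G(𝔸_f)` cannot have `f_B` off the line of `f_A`; a
non-proportional pair needs a non-trivial `Gf`. The toy data satisfy `TrivialAction`
(`toyV_trivialAction`).

§8(d): uses an L-value-free non-vanishing device: NO.
-/

namespace Summit.Ventures.HodgeRepro2.T6.N3Datum

open scoped InnerProductSpace

variable (𝒟 : N3Datum)

/-- The action of `G(𝔸_f)` on `L²([G])` is trivial: `ρ g = id` for every `g` (every toy datum so far). -/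
def TrivialAction : Prop := ∀ (g : 𝒟.Gf) (x : 𝒟.LG), 𝒟.ρ g x = x

variable {𝒟}

/-- Under a trivial action every linear map between τ-parts is equivariant, so `AutNonIso` leaves at
most ONE non-zero τ-part: two indices with non-zero τ-parts coincide. -/
theorem eq_of_tauPart_ne_bot (htriv : 𝒟.TrivialAction) (hst : 𝒟.AutStable)
    (hnon : 𝒟.AutNonIso hst) {i j : 𝒟.Aut} (hi : 𝒟.aut i ⊓ 𝒟.τiso ≠ ⊥)
    (hj : 𝒟.aut j ⊓ 𝒟.τiso ≠ ⊥) : i = j := by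
  by_contra hij
  obtain ⟨x, hx, hx0⟩ := Submodule.exists_mem_ne_zero_of_ne_bot hi
  obtain ⟨y, hy, hy0⟩ := Submodule.exists_mem_ne_zero_of_ne_bot hj
  -- the rank-one map `z ↦ ⟪x, z⟫ • y` from the τ-part of `i` to the τ-part of `j`
  let T : ↥(𝒟.aut i ⊓ 𝒟.τiso) →ₗ[ℂ] ↥(𝒟.aut j ⊓ 𝒟.τiso) :=
    (((innerSL ℂ x : 𝒟.LG →L[ℂ] ℂ) : 𝒟.LG →ₗ[ℂ] ℂ).comp (𝒟.aut i ⊓ 𝒟.τiso).subtype).smulRight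
      ⟨y, hy⟩
  have hT : T = 0 := hnon i j hij T (fun g z => by
    have hz : (⟨𝒟.ρ g z, hst i g z z.2⟩ : ↥(𝒟.aut i ⊓ 𝒟.τiso)) = z := Subtype.ext (htriv g z)
    rw [hz, htriv])
  have hTx : (T ⟨x, hx⟩ : 𝒟.LG) = ⟪x, x⟫_ℂ • y := rfl
  rw [hT] at hTx
  simp only [LinearMap.zero_apply, Submodule.coe_zero] at hTx
  rcases smul_eq_zero.mp hTx.symm with h | h
  · exact hx0 (inner_self_eq_zero.mp h)
  · exact hy0 h

/-- Under a trivial action every subspace is stable, so `AutSimple` makes a τ-part the LINE through any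
of its non-zero vectors. -/
theorem tauPart_eq_span_singleton (htriv : 𝒟.TrivialAction) (hsimp : 𝒟.AutSimple) {i : 𝒟.Aut}
    {x : 𝒟.LG} (hx : x ∈ 𝒟.aut i ⊓ 𝒟.τiso) (hx0 : x ≠ 0) : 𝒟.aut i ⊓ 𝒟.τiso = ℂ ∙ x := by
  rcases hsimp i (ℂ ∙ x) ((Submodule.span_singleton_le_iff_mem x _).mpr hx)
      (fun g z hz => by rw [htriv]; exact hz) with h | h
  · exact absurd (Submodule.span_singleton_eq_bot.mp h) hx0
  · exact h.symm

/-- Under a trivial action with `AutNonIso` and `AutSimple`, `𝒱 = V20` (the sum of the τ-parts) is a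
line `ℂ ∙ u` (possibly `⊥ = ℂ ∙ 0`). -/
theorem exists_V20_eq_span_singleton (htriv : 𝒟.TrivialAction) (hst : 𝒟.AutStable)
    (hnon : 𝒟.AutNonIso hst) (hsimp : 𝒟.AutSimple) : ∃ u : 𝒟.LG, 𝒟.V20 = ℂ ∙ u := by
  by_cases h : ∃ i, 𝒟.aut i ⊓ 𝒟.τiso ≠ ⊥
  · obtain ⟨i, hi⟩ := h
    obtain ⟨x, hx, hx0⟩ := Submodule.exists_mem_ne_zero_of_ne_bot hi
    refine ⟨x, ?_⟩
    rw [← tauPart_eq_span_singleton htriv hsimp hx hx0]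
    show (⨆ j : 𝒟.Aut, 𝒟.aut j ⊓ 𝒟.τiso) = 𝒟.aut i ⊓ 𝒟.τiso
    refine le_antisymm (iSup_le fun j => ?_) (le_iSup (fun j => 𝒟.aut j ⊓ 𝒟.τiso) i)
    by_cases hj : 𝒟.aut j ⊓ 𝒟.τiso = ⊥
    · rw [hj]; exact bot_le
    · rw [eq_of_tauPart_ne_bot htriv hst hnon hj hi]
  · push Not at h
    refine ⟨0, ?_⟩
    rw [Submodule.span_zero_singleton]
    show (⨆ j : 𝒟.Aut, 𝒟.aut j ⊓ 𝒟.τiso) = ⊥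
    exact iSup_eq_bot.mpr h

/-- THE ONE-LINE LEMMA: under a trivial action, `AutNonIso` + `AutSimple` + `ProductsIn20` on both
sides put EVERY product of vertex forms of side A and of side B on one line `ℂ ∙ u`. -/
theorem exists_products_mem_span_singleton (htriv : 𝒟.TrivialAction) (hst : 𝒟.AutStable)
    (hnon : 𝒟.AutNonIso hst) (hsimp : 𝒟.AutSimple) (hPX : 𝒟.ProductsIn20 𝒟.A)
    (hPY : 𝒟.ProductsIn20 𝒟.B) :
    ∃ u : 𝒟.LG, (∀ φa φb, 𝒟.A.F φa φb ∈ ℂ ∙ u) ∧ (∀ φc φd, 𝒟.B.F φc φd ∈ ℂ ∙ u) := by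
  obtain ⟨u, hu⟩ := exists_V20_eq_span_singleton htriv hst hnon hsimp
  refine ⟨u, fun φa φb => ?_, fun φc φd => ?_⟩
  · rw [← hu]; exact hPX (Submodule.subset_span ⟨(φa, φb), rfl⟩)
  · rw [← hu]; exact hPY (Submodule.subset_span ⟨(φc, φd), rfl⟩)

/-- Under a trivial action, every element of side B's product module lies on the line of any
non-zero element of side A's product module. -/
theorem mem_span_singleton_of_mem_productModule (htriv : 𝒟.TrivialAction) (hst : 𝒟.AutStable)
    (hnon : 𝒟.AutNonIso hst) (hsimp : 𝒟.AutSimple) (hPX : 𝒟.ProductsIn20 𝒟.A)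
    (hPY : 𝒟.ProductsIn20 𝒟.B) {x y : 𝒟.LG} (hx : x ∈ 𝒟.productModule 𝒟.A) (hx0 : x ≠ 0)
    (hy : y ∈ 𝒟.productModule 𝒟.B) : y ∈ ℂ ∙ x := by
  obtain ⟨u, hu⟩ := exists_V20_eq_span_singleton htriv hst hnon hsimp
  have hx' : x ∈ ℂ ∙ u := hu ▸ hPX hx
  have hy' : y ∈ ℂ ∙ u := hu ▸ hPY hy
  obtain ⟨a, rfl⟩ := Submodule.mem_span_singleton.mp hx'
  have ha : a ≠ 0 := fun h => hx0 (by rw [h, zero_smul])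
  rw [Submodule.span_singleton_smul_eq (IsUnit.mk0 a ha)]
  exact hy'

/-- THE CONSTRAINT ON A JOINT TOY: under a trivial action, every product of side B is a multiple of any
non-zero product of side A — for `F_A = (φ_a φ_b) • f_A`, `F_B = (φ_c φ_d) • f_B` this is
`f_B ∈ ℂ ∙ f_A`. -/
theorem B_F_mem_span_A_F (htriv : 𝒟.TrivialAction) (hst : 𝒟.AutStable) (hnon : 𝒟.AutNonIso hst)
    (hsimp : 𝒟.AutSimple) (hPX : 𝒟.ProductsIn20 𝒟.A) (hPY : 𝒟.ProductsIn20 𝒟.B) (φa : 𝒟.A.Sa)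
    (φb : 𝒟.A.Sb) (h0 : 𝒟.A.F φa φb ≠ 0) (φc : 𝒟.B.Sa) (φd : 𝒟.B.Sb) :
    𝒟.B.F φc φd ∈ ℂ ∙ 𝒟.A.F φa φb :=
  mem_span_singleton_of_mem_productModule htriv hst hnon hsimp hPX hPY
    (Submodule.subset_span ⟨(φa, φb), rfl⟩) h0 (Submodule.subset_span ⟨(φc, φd), rfl⟩)

/-! ## 2. ONE-LINE PRODUCTS under ANY `G(𝔸_f)` (appended v2, g7) -/

/-- ONE-LINE PRODUCTS, ANY ACTION: if every product of side A lies on the line `ℂ ∙ fA` and every product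
of side B on the line `ℂ ∙ fB` (t6-p1's wiring `F_A = (φa φb) • f_A`, `F_B = (φc φd) • f_B`, STATUS
l. 11284 (S6)–(S7)), then the N3.L8 interface Props together with `ℓ_A^σ ≢ 0` and `ℓ_B^σ ≢ 0` force the
two lines to COINCIDE: `ℂ ∙ fB = ℂ ∙ fA` — no choice of `G(𝔸_f)` or of its action avoids it (the
τ-part `σ^τ` is non-zero and lies in both product modules, `tauPart_le_productModule`). -/
theorem span_eq_of_products_on_lines (hO : 𝒟.AutOrthogonal) (hst : 𝒟.AutStable)
    (hsimp : 𝒟.AutSimple) (hnon : 𝒟.AutNonIso hst) (hPX : 𝒟.ProductsIn20 𝒟.A)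
    (hPeqX : 𝒟.ProductEquivariant 𝒟.A) (hPY : 𝒟.ProductsIn20 𝒟.B)
    (hPeqY : 𝒟.ProductEquivariant 𝒟.B) (hσX : 𝒟.SigmaIsAut 𝒟.A) (hσ : 𝒟.B.σ = 𝒟.A.σ)
    (hA : 𝒟.ellNonzero 𝒟.A) (hB : 𝒟.ellNonzero 𝒟.B) {fA fB : 𝒟.LG}
    (hFA : ∀ φa φb, 𝒟.A.F φa φb ∈ ℂ ∙ fA) (hFB : ∀ φc φd, 𝒟.B.F φc φd ∈ ℂ ∙ fB) :
    (ℂ ∙ fB) = ℂ ∙ fA := by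
  obtain ⟨i₀, hi₀⟩ := hσX
  have hA' := 𝒟.tauPart_le_productModule hO hst hsimp hnon 𝒟.A hPX hPeqX hi₀ hA
  have hB' := 𝒟.tauPart_le_productModule hO hst hsimp hnon 𝒟.B hPY hPeqY (hi₀.trans hσ.symm) hB
  have hMA : 𝒟.productModule 𝒟.A ≤ ℂ ∙ fA := by
    refine Submodule.span_le.mpr ?_
    rintro _ ⟨p, rfl⟩
    exact hFA p.1 p.2
  have hMB : 𝒟.productModule 𝒟.B ≤ ℂ ∙ fB := by
    refine Submodule.span_le.mpr ?_
    rintro _ ⟨p, rfl⟩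
    exact hFB p.1 p.2
  obtain ⟨φa, φb, ψ, hψ, hne⟩ := hA
  have hψσ : ψ ∈ 𝒟.tauPart i₀ := ⟨by rw [hi₀]; exact hψ.1, hψ.2⟩
  have hψ0 : ψ ≠ 0 := fun h => hne (by
    show ⟪ψ, 𝒟.A.F φa φb⟫_ℂ = 0
    rw [h, inner_zero_left])
  obtain ⟨a, ha⟩ := Submodule.mem_span_singleton.mp (hMA (hA' hψσ))
  obtain ⟨b, hb⟩ := Submodule.mem_span_singleton.mp (hMB (hB' hψσ))
  have ha0 : a ≠ 0 := fun h => hψ0 (by rw [← ha, h, zero_smul])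
  have hb0 : b ≠ 0 := fun h => hψ0 (by rw [← hb, h, zero_smul])
  have hfA : (ℂ ∙ fA) = ℂ ∙ ψ := by
    rw [← ha, Submodule.span_singleton_smul_eq (IsUnit.mk0 a ha0)]
  have hfB : (ℂ ∙ fB) = ℂ ∙ ψ := by
    rw [← hb, Submodule.span_singleton_smul_eq (IsUnit.mk0 b hb0)]
  rw [hfA, hfB]

/-- The same, read as `fB ∈ ℂ ∙ fA`: a joint toy with one-line products on each side (t6-p1's (S6))
has `f_B` a multiple of `f_A`, whatever the group. -/
theorem mem_span_of_products_on_lines (hO : 𝒟.AutOrthogonal) (hst : 𝒟.AutStable)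
    (hsimp : 𝒟.AutSimple) (hnon : 𝒟.AutNonIso hst) (hPX : 𝒟.ProductsIn20 𝒟.A)
    (hPeqX : 𝒟.ProductEquivariant 𝒟.A) (hPY : 𝒟.ProductsIn20 𝒟.B)
    (hPeqY : 𝒟.ProductEquivariant 𝒟.B) (hσX : 𝒟.SigmaIsAut 𝒟.A) (hσ : 𝒟.B.σ = 𝒟.A.σ)
    (hA : 𝒟.ellNonzero 𝒟.A) (hB : 𝒟.ellNonzero 𝒟.B) {fA fB : 𝒟.LG}
    (hFA : ∀ φa φb, 𝒟.A.F φa φb ∈ ℂ ∙ fA) (hFB : ∀ φc φd, 𝒟.B.F φc φd ∈ ℂ ∙ fB) :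
    fB ∈ ℂ ∙ fA := by
  rw [← span_eq_of_products_on_lines hO hst hsimp hnon hPX hPeqX hPY hPeqY hσX hσ hA hB hFA hFB]
  exact Submodule.mem_span_singleton_self fB

end Summit.Ventures.HodgeRepro2.T6.N3Datum

namespace Summit.Ventures.HodgeRepro2.T6.N3ToyV

open Summit.Ventures.HodgeRepro2.T6

variable {V : Type} [NormedAddCommGroup V] [InnerProductSpace ℂ V] [CompleteSpace V]

/-- The toy datum on `V` has a trivial action. -/
theorem toyV_trivialAction (v : V) : (toyV V v).TrivialAction := fun _ _ => rfl

end Summit.Ventures.HodgeRepro2.T6.N3ToyV
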